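import Summits.CriticalPhenomena.SAWScalingLimit.Theses.SAWRestrictionRigidity
import Summits.CriticalPhenomena.SAWScalingLimit.Theorems.SAWRestrictionRigidityRigidityOfCocycleCore

/-!
# Skeleton for the RESTATED crux C′ (line `registered`, scalar cut + Radó binder) — lead c4, 2026-08-17

Prepared for whoever is seated AFTER the planner restates stmt-CriticalPhenomena-1368 as C′
(`Cruxes/Rigidity/Repair.lean`, `Repair.RigidityC`): the scalar / avoidance-cocycle cut of lead c2
survives verbatim with ONE more binder. The only `sorry` is `stub_cocycleConformalC` = the
conformal invariance of the avoidance cocycle `c(D, D') = P D {γ ⊆ closure D'}` under the seven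
lattice-exact axioms AND Radó continuity of `D ↦ P D` (the open problem of LSW04 §3.4.5 in scalar
form); `RigidityC_of` assembles C′ from it through the LANDED bookkeeping theorems
(`stub_covarianceOfCocycle` p148944, `stub_closureHomeomorph` p148398, `stub_pushforwardCarried`
p148424, `stub_preimageSubdomain` p148391), exactly as `rigidity_of_cocycleCore` (p149643) does for
the typed crux. The conclusion of `RigidityC_of` is the body of `Repair.RigidityC` verbatim (the
restated decl does not exist yet, so it cannot be named; re-point it at the route decl once the
planner has restated, then `ledger skeleton check`).

lean check (2026-08-17, lead c4): rc 0, 1 sorry (`stub_cocycleConformalC`).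
-/

namespace Summit.CriticalPhenomena.SAWScalingLimit.Cruxes.Rigidity.CocycleC

open MeasureTheory
open Summit.CriticalPhenomena.SAWScalingLimit.Cruxes.Rigidity.Cocycle

/-- stub 1 of the restated line (hardest; the conjectural core in SCALAR form WITH the Radó-continuity binder): under the seven typed hypotheses and Radó continuity of `D ↦ P D`, the avoidance cocycle is conformally invariant (same test data as `Cocycle.stub_cocycleConformal`). Open in print (LSW04 §3.4.5); no longer exposed to domain-keyed families (AUDIT-c4.md §3, §6). -/
theorem stub_cocycleConformalC : ∀ P : Literature.Probability.RandomPlanarGeometry.ChordalFamily, P.IsChordal → P.IsRestriction → (∃ Q : Literature.Probability.RandomPlanarGeometry.DobrushinDomain → Literature.Probability.RandomPlanarGeometry.CurveClass ℂ → MeasureTheory.Measure (Literature.Probability.RandomPlanarGeometry.CurveClass ℂ), P.IsMarkovExtension Q ∧ ∀ (D : Literature.Probability.RandomPlanarGeometry.DobrushinDomain) (p : Literature.Probability.RandomPlanarGeometry.CurveClass ℂ) (D' : Literature.Probability.RandomPlanarGeometry.DobrushinDomain), D'.carrier ⊆ Literature.Probability.RandomPlanarGeometry.remainingDomain D p → D'.pt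 0 = p.target → D'.pt 1 = D.pt 1 → ∀ T : Set (Literature.Probability.RandomPlanarGeometry.CurveClass ℂ), MeasurableSet T → P D' T * Q D p (Literature.Probability.RandomPlanarGeometry.CurveClass.rangeSubset (closure D'.carrier)) = Q D p (T ∩ Literature.Probability.RandomPlanarGeometry.CurveClass.rangeSubset (closure D'.carrier))) → (∀ D D' : Literature.Probability.RandomPlanarGeometry.DobrushinDomain, D'.carrier = D.carrier → D'.pt 0 = D.pt 1 → D'.pt 1 = D.pt 0 → P D' = (P D).map Literature.Probability.RandomPlanarGeometry.CurveClass.reverse) → (∀ (D : Literature.Probability.RandomPlanarGeometry.DobrushinDomain) (c : ℂ) (hc : c ≠ 0) (w : ℂ), (∃ (r : ℝ) (k : ℕ), 0 < r ∧ c = (r : ℂ) * Complex.I ^ k) → P (D.map (Literature.Probability.RandomPlanarGeometry.similarity c hc w)) = (P D).map (Literature.Probability.RandomPlanarGeometry.CurveClass.map (Literature.Probability.RandomPlanarGeometry.similarity c hc w : C(ℂ, ℂ)))) → (∀ D : Literature.Probability.RandomPlanarGeometry.DobrushinDomain, P (D.map Complex.conjLIE.toHomeomorph) = (P D).map (Literature.Probability.RandomPlanarGeometry.CurveClass.map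 (Complex.conjLIE.toHomeomorph : C(ℂ, ℂ)))) → (∀ D : Literature.Probability.RandomPlanarGeometry.DobrushinDomain, ∀ᵐ γ ∂(P D), γ ∈ Literature.Probability.RandomPlanarGeometry.CurveClass.simple ∧ γ.range ∩ frontier D.carrier ⊆ {D.pt 0, D.pt 1}) → (∀ (D D' : Literature.Probability.RandomPlanarGeometry.DobrushinDomain) (Dn : ℕ → Literature.Probability.RandomPlanarGeometry.DobrushinDomain) (Φ : C(ℂ, ℂ)) (Φn : ℕ → C(ℂ, ℂ)), TendstoUniformlyOn (fun n => ⇑(Φn n)) Φ Filter.atTop (closure D.carrier) → DifferentiableOn ℂ Φ D.carrier → Set.InjOn Φ (closure D.carrier) → (∀ n, DifferentiableOn ℂ (Φn n) D.carrier ∧ Set.InjOn (Φn n) (closure D.carrier)) → D'.carrier = Φ '' D.carrier → D'.pt 0 = Φ (D.pt 0) → D'.pt 1 = Φ (D.pt 1) → (∀ n, (Dn n).carrier = Φn n '' D.carrier ∧ (Dn n).pt 0 = Φn n (D.pt 0) ∧ (Dn n).pt 1 = Φn n (D.pt 1)) → ∀ f : BoundedContinuousFunction (Literature.Probability.RandomPlanarGeometry.CurveClass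 ℂ) ℝ, Filter.Tendsto (fun n => ∫ γ, f γ ∂(P (Dn n))) Filter.atTop (nhds (∫ γ, f γ ∂(P D')))) → ∀ (D D₂ : Literature.Probability.RandomPlanarGeometry.DobrushinDomain) (g : Literature.Probability.RandomPlanarGeometry.ConformalEquiv D.carrier D₂.carrier) (Φ : C(ℂ, ℂ)), g.HasBoundaryValue (D.pt 0) (D₂.pt 0) → g.HasBoundaryValue (D.pt 1) (D₂.pt 1) → Set.EqOn Φ g D.carrier → Set.InjOn Φ (closure D.carrier) → ∀ (D' D₂' : Literature.Probability.RandomPlanarGeometry.DobrushinDomain), D'.carrier ⊆ D.carrier → D'.pt 0 = D.pt 0 → D'.pt 1 = D.pt 1 → D₂'.carrier ⊆ D₂.carrier → D₂'.pt 0 = D₂.pt 0 → D₂'.pt 1 = D₂.pt 1 → (∃ ε : ℝ, 0 < ε ∧ D'.carrier ∩ Metric.ball (D.pt 0) ε = D.carrier ∩ Metric.ball (D.pt 0) ε ∧ D'.carrier ∩ Metric.ball (D.pt 1) ε = D.carrier ∩ Metric.ball (D.pt 1) ε) → (∃ ε : ℝ, 0 < ε ∧ D₂'.carrier ∩ Metric.ball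 (D₂.pt 0) ε = D₂.carrier ∩ Metric.ball (D₂.pt 0) ε ∧ D₂'.carrier ∩ Metric.ball (D₂.pt 1) ε = D₂.carrier ∩ Metric.ball (D₂.pt 1) ε) → Φ '' closure D'.carrier = closure D₂'.carrier → P D (Literature.Probability.RandomPlanarGeometry.CurveClass.rangeSubset (closure D'.carrier)) = P D₂ (Literature.Probability.RandomPlanarGeometry.CurveClass.rangeSubset (closure D₂'.carrier)) := by
  sorry

/-- Assembly (real proof, no `sorry` of its own): the restated crux C′ (body of `Repair.RigidityC`, verbatim) from the scalar core BY NAME through the landed bookkeeping of line `registered`. -/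
theorem RigidityC_of : ∀ P : Literature.Probability.RandomPlanarGeometry.ChordalFamily, P.IsChordal → P.IsRestriction → (∃ Q : Literature.Probability.RandomPlanarGeometry.DobrushinDomain → Literature.Probability.RandomPlanarGeometry.CurveClass ℂ → MeasureTheory.Measure (Literature.Probability.RandomPlanarGeometry.CurveClass ℂ), P.IsMarkovExtension Q ∧ ∀ (D : Literature.Probability.RandomPlanarGeometry.DobrushinDomain) (p : Literature.Probability.RandomPlanarGeometry.CurveClass ℂ) (D' : Literature.Probability.RandomPlanarGeometry.DobrushinDomain), D'.carrier ⊆ Literature.Probability.RandomPlanarGeometry.remainingDomain D p → D'.pt 0 = p.target → D'.pt 1 = D.pt 1 → ∀ T : Set (Literature.Probability.RandomPlanarGeometry.CurveClass ℂ), MeasurableSet T → P D' T * Q D p (Literature.Probability.RandomPlanarGeometry.CurveClass.rangeSubset (closure D'.carrier)) = Q D p (T ∩ Literature.Probability.RandomPlanarGeometry.CurveClass.rangeSubset (closure D'.carrier))) → (∀ D D' : Literature.Probability.RandomPlanarGeometry.DobrushinDomain, D'.carrier = D.carrier → D'.pt 0 = D.pt 1 → D'.pt 1 = D.pt 0 →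 P D' = (P D).map Literature.Probability.RandomPlanarGeometry.CurveClass.reverse) → (∀ (D : Literature.Probability.RandomPlanarGeometry.DobrushinDomain) (c : ℂ) (hc : c ≠ 0) (w : ℂ), (∃ (r : ℝ) (k : ℕ), 0 < r ∧ c = (r : ℂ) * Complex.I ^ k) → P (D.map (Literature.Probability.RandomPlanarGeometry.similarity c hc w)) = (P D).map (Literature.Probability.RandomPlanarGeometry.CurveClass.map (Literature.Probability.RandomPlanarGeometry.similarity c hc w : C(ℂ, ℂ)))) → (∀ D : Literature.Probability.RandomPlanarGeometry.DobrushinDomain, P (D.map Complex.conjLIE.toHomeomorph) = (P D).map (Literature.Probability.RandomPlanarGeometry.CurveClass.map (Complex.conjLIE.toHomeomorph : C(ℂ, ℂ)))) → (∀ D : Literature.Probability.RandomPlanarGeometry.DobrushinDomain, ∀ᵐ γ ∂(P D), γ ∈ Literature.Probability.RandomPlanarGeometry.CurveClass.simple ∧ γ.range ∩ frontier D.carrier ⊆ {D.pt 0, D.pt 1}) → (∀ (D D' : Literature.Probability.RandomPlanarGeometry.DobrushinDomain) (Dn : ℕ → Literature.Probability.RandomPlanarGeometry.DobrushinDomain)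 (Φ : C(ℂ, ℂ)) (Φn : ℕ → C(ℂ, ℂ)), TendstoUniformlyOn (fun n => ⇑(Φn n)) Φ Filter.atTop (closure D.carrier) → DifferentiableOn ℂ Φ D.carrier → Set.InjOn Φ (closure D.carrier) → (∀ n, DifferentiableOn ℂ (Φn n) D.carrier ∧ Set.InjOn (Φn n) (closure D.carrier)) → D'.carrier = Φ '' D.carrier → D'.pt 0 = Φ (D.pt 0) → D'.pt 1 = Φ (D.pt 1) → (∀ n, (Dn n).carrier = Φn n '' D.carrier ∧ (Dn n).pt 0 = Φn n (D.pt 0) ∧ (Dn n).pt 1 = Φn n (D.pt 1)) → ∀ f : BoundedContinuousFunction (Literature.Probability.RandomPlanarGeometry.CurveClass ℂ) ℝ, Filter.Tendsto (fun n => ∫ γ, f γ ∂(P (Dn n))) Filter.atTop (nhds (∫ γ, f γ ∂(P D')))) → P.IsConformallyCovariant := by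
  intro P hch hres hmk hrev hsim hconj hsimple hcont
  exact stub_covarianceOfCocycle stub_closureHomeomorph stub_pushforwardCarried stub_preimageSubdomain
    P hch hsimple (stub_cocycleConformalC P hch hres hmk hrev hsim hconj hsimple hcont)

end Summit.CriticalPhenomena.SAWScalingLimit.Cruxes.Rigidity.CocycleC
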